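import Mathlib.NumberTheory.NumberField.Discriminant.Different
import HarnessLib

/-!
# An everywhere unramified extension of number fields has discriminant `|d_L| = |d_K|^{[L:K]}`
# (Neukirch, *Algebraic Number Theory*, Ch. III, Thm. (2.6), Thm. (2.9), Cor. (2.10))

Topic `NumberTheory/NumberFields`.  Theorem-only file (no definition, no named fact).  For number fields
`K ⊆ L`:

* `differentIdeal_eq_top_of_forall_isUnramifiedAt` — if every maximal ideal of `𝓞_L` is unramified
  over `𝓞_K` (Mathlib's `Algebra.IsUnramifiedAt`), the relative different `𝔇(𝓞_L/𝓞_K)` is the unit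
  ideal (Neukirch III (2.6): "A prime ideal `𝔓` of `L` is ramified over `K` if and only if `𝔓 ∣ 𝔇_{L|K}`";
  Mathlib `not_dvd_differentIdeal_iff`);
* `natAbs_discr_eq_pow_of_forall_isUnramifiedAt` — hence **`|d_L| = |d_K|^{[L:K]}`** (Neukirch III
  (2.9) `𝔡_{L|K} = N_{L|K}(𝔇_{L|K})` and (2.10) `𝔡_{M|K} = 𝔡_{L|K}^{[M:L]} N_{L|K}(𝔡_{M|L})` with
  `K = ℚ`; Mathlib `NumberField.natAbs_discr_eq_absNorm_differentIdeal_mul_natAbs_discr_pow`).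

This is the form in which the Hilbert class field enters Granville–Stark's Lemma 1 (*ABC implies no
Siegel zeros*, Invent. Math. 139 (2000), §2): `K(j(τ_D))/K` unramified gives root discriminant `√|d_K|`
(`Literature/NumberTheory/DiophantineGeometry/AbcWave0GranvilleStarkTheorem1HilbertKummerProofs.lean`).

## References

* J. Neukirch, *Algebraic Number Theory*, Grundlehren 322, Springer 1999, Ch. III §2: Thm. (2.6),
  Thm. (2.9), Cor. (2.10) (held copy `book:bynd-algebraic-number-theory`, PDF pp. 185–187).
  [NeukirchANT1999]
-/

noncomputable section

open NumberField Ideal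

namespace Literature.NumberTheory.NumberFields

variable {K L : Type*} [Field K] [NumberField K] [Field L] [NumberField L] [Algebra K L]

/-- **Everywhere unramified ⟹ trivial different**: if every maximal ideal of `𝓞_L` is unramified over
`𝓞_K`, then `𝔇(𝓞_L/𝓞_K) = (1)` (Neukirch III (2.6): the primes dividing the different are exactly the
ramified ones). [cite: NeukirchANT1999, Ch. III Thm. (2.6)] -/
theorem differentIdeal_eq_top_of_forall_isUnramifiedAt
    (h : ∀ (P : Ideal (𝓞 L)) [P.IsMaximal], Algebra.IsUnramifiedAt (𝓞 K) P) :
    differentIdeal (𝓞 K) (𝓞 L) = ⊤ := by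
  -- the compatible algebra structure on the abstract fraction fields (Mathlib keeps it non-instance)
  letI : Algebra (FractionRing (𝓞 K)) (FractionRing (𝓞 L)) := FractionRing.liftAlgebra _ _
  by_contra hne
  obtain ⟨P, hPmax, hle⟩ := Ideal.exists_le_maximal _ hne
  have hdvd : P ∣ differentIdeal (𝓞 K) (𝓞 L) := Ideal.dvd_iff_le.mpr hle
  have : Algebra.IsSeparable (FractionRing (𝓞 K)) (FractionRing (𝓞 L)) := by
    refine Algebra.IsSeparable.of_equiv_equiv (FractionRing.algEquiv (𝓞 K) K).symm.toRingEquiv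
      (FractionRing.algEquiv (𝓞 L) L).symm.toRingEquiv ?_
    ext x
    exact IsFractionRing.algEquiv_commutes (FractionRing.algEquiv (𝓞 K) K).symm
      (FractionRing.algEquiv (𝓞 L) L).symm _
  exact (not_dvd_differentIdeal_iff.mpr (h P)) hdvd

/-- **Discriminant of an everywhere unramified extension**: if every maximal ideal of `𝓞_L` is
unramified over `𝓞_K`, then `|d_L| = |d_K|^{[L:K]}` (Neukirch III (2.9)–(2.10):
`𝔡_{L|ℚ} = 𝔡_{K|ℚ}^{[L:K]} N_{K|ℚ}(𝔡_{L|K})` with `𝔡_{L|K} = N_{L|K}(𝔇_{L|K}) = (1)`).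
[cite: NeukirchANT1999, Ch. III Thm. (2.9) and Cor. (2.10)] -/
theorem natAbs_discr_eq_pow_of_forall_isUnramifiedAt
    (h : ∀ (P : Ideal (𝓞 L)) [P.IsMaximal], Algebra.IsUnramifiedAt (𝓞 K) P) :
    (discr L).natAbs = (discr K).natAbs ^ Module.finrank K L := by
  have := NumberField.natAbs_discr_eq_absNorm_differentIdeal_mul_natAbs_discr_pow K (𝓞 K) L (𝓞 L)
  rwa [differentIdeal_eq_top_of_forall_isUnramifiedAt h, Ideal.absNorm_top, one_mul] at this

end Literature.NumberTheory.NumberFields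

end
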